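import Summits.KontsevichZagierPeriods.KontsevichZagierPeriods.Theorems.SoloInformedAlgGermStep
import Mathlib.Algebra.Polynomial.Reverse
import HarnessLib

/-!
# The DEN-calculus over `K`: multiplicity and the tangent cone at the vertex

Solo programme `solo-KontsevichZagierPeriods-informed`, session s107, step (x-k) of the general
two-dimensional algorithm: the algebra of the tangent cone of `F ∈ K[x₀, x₁]` at `0`.

* `soloInformedMultK F` — the multiplicity of `F` at `0` (least total degree of a monomial);
* `soloInformed_coeff_blowLowK` — coefficients of the lower blow-up chart `F_low`;
* `soloInformedConePolyK F m = F_low(0, ·) ∈ K[t]` — the **cone polynomial** (the degree-`m` form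
  of `F` read on the exceptional edge), its coefficients, degree and non-vanishing; the cone
  polynomial of `swap F` is the reflection (coefficient reversal) of that of `F`;
* `soloInformed_edgePolyK_childK` — the child germ `F_low(κx₀, t + λx₁)` restricted to the edge
  `x₀ = 0` is `cone(t + λ·)`; hence `mult(child) ≤ k` whenever `cone(t + λ·)` has a degree-`k` term,
  and **the pure-power lemma**: if `mult(child at t) ≥ m` then `cone = c · (X − t)^m`.

References: J. Kollár, *Lectures on Resolution of Singularities* (2007), §1.10;
M. Kontsevich, D. Zagier, *Periods* (2001), §1.2.
-/

noncomputable section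

open scoped BigOperators
open MeasureTheory Set Polynomial
open Literature.NumberTheory.Transcendental Literature.NumberTheory.Transcendental.KZ

namespace Summit.KontsevichZagierPeriods.KontsevichZagierPeriods.Theorems

variable {K : Type*} [Field K] [Algebra K ℝ]

/-! ### Multiplicity at the origin -/

omit [Algebra K ℝ] in
/-- The **multiplicity** of `F ∈ K[x₀, x₁]` at the origin: the least total degree of a monomial of
`F` (`0` for `F = 0`). [this work] -/
def soloInformedMultK (F : MvPolynomial (Fin 2) K) : ℕ :=
  if h : F.support.Nonempty then F.support.inf' h (fun a => a 0 + a 1) else 0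

omit [Algebra K ℝ] in
/-- Every monomial has total degree at least the multiplicity. [this work] -/
theorem soloInformed_multK_le {F : MvPolynomial (Fin 2) K} {a : Fin 2 →₀ ℕ} (ha : a ∈ F.support) :
    soloInformedMultK F ≤ a 0 + a 1 := by
  unfold soloInformedMultK
  rw [dif_pos ⟨a, ha⟩]
  exact Finset.inf'_le _ ha

omit [Algebra K ℝ] in
/-- The multiplicity is attained. [this work] -/
theorem soloInformed_exists_deg_eq_multK {F : MvPolynomial (Fin 2) K} (hF : F ≠ 0) :
    ∃ a ∈ F.support, a 0 + a 1 = soloInformedMultK F := by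
  have hne : F.support.Nonempty := MvPolynomial.support_nonempty.2 hF
  unfold soloInformedMultK
  rw [dif_pos hne]
  obtain ⟨a, ha, h⟩ := Finset.exists_mem_eq_inf' hne (fun a : Fin 2 →₀ ℕ => a 0 + a 1)
  exact ⟨a, ha, h.symm⟩

/-- The value at the origin is the constant coefficient. [this work] -/
theorem soloInformed_aevalK_zero (F : MvPolynomial (Fin 2) K) :
    (MvPolynomial.aeval (0 : Fin 2 → ℝ) F : ℝ) = algebraMap K ℝ (MvPolynomial.coeff 0 F) := by
  rw [MvPolynomial.aeval_zero, ← MvPolynomial.constantCoeff_eq]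

/-- A non-zero polynomial of multiplicity `0` does not vanish at the origin. [this work] -/
theorem soloInformed_aevalK_zero_ne_of_multK {F : MvPolynomial (Fin 2) K} (hF : F ≠ 0)
    (h : soloInformedMultK F = 0) : (MvPolynomial.aeval (0 : Fin 2 → ℝ) F : ℝ) ≠ 0 := by
  obtain ⟨a, ha, hdeg⟩ := soloInformed_exists_deg_eq_multK hF
  rw [h] at hdeg
  have ha0 : a = 0 := by
    ext j
    fin_cases j
    · show a 0 = 0; omega
    · show a 1 = 0; omega
  rw [soloInformed_aevalK_zero, _root_.map_ne_zero]
  rw [ha0] at ha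
  exact MvPolynomial.mem_support_iff.1 ha

/-! ### Coefficients of the lower blow-up chart -/

omit [Algebra K ℝ] in
/-- Normal form of the lower blow-up chart quotient. [this work] -/
theorem soloInformed_blowLowK_eq_sum (F : MvPolynomial (Fin 2) K) (m : ℕ) :
    soloInformedBlowLowK F m = ∑ a ∈ F.support, MvPolynomial.monomial
      (Finsupp.single 0 (a 0 + a 1 - m) + Finsupp.single 1 (a 1)) (MvPolynomial.coeff a F) := by
  unfold soloInformedBlowLowK soloInformedChartQuotK
  refine Finset.sum_congr rfl fun a _ => ?_
  have hs : (Finsupp.equivFunOnFinite.symm fun j => (∑ i, soloInformedLowerMat i j * a i) - ![m, 0] j :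
      Fin 2 →₀ ℕ) = Finsupp.single 0 (a 0 + a 1 - m) + Finsupp.single 1 (a 1) := by
    ext j
    fin_cases j <;> simp [soloInformedLowerMat, Fin.sum_univ_two]
  rw [hs]

omit [Algebra K ℝ] in
/-- **Coefficients of the lower chart**: the coefficient of `v₀^{b₀} v₁^{b₁}` in `F_low` is the
coefficient of `x₀^{b₀+m−b₁} x₁^{b₁}` in `F`. [this work] -/
theorem soloInformed_coeff_blowLowK (F : MvPolynomial (Fin 2) K) {m : ℕ}
    (hm : ∀ a ∈ F.support, m ≤ a 0 + a 1) (b : Fin 2 →₀ ℕ) :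
    MvPolynomial.coeff b (soloInformedBlowLowK F m) =
      if b 1 ≤ b 0 + m then
        MvPolynomial.coeff (Finsupp.single 0 (b 0 + m - b 1) + Finsupp.single 1 (b 1)) F else 0 := by
  classical
  rw [soloInformed_blowLowK_eq_sum, MvPolynomial.coeff_sum]
  simp only [MvPolynomial.coeff_monomial]
  set a₀ : Fin 2 →₀ ℕ := Finsupp.single 0 (b 0 + m - b 1) + Finsupp.single 1 (b 1) with ha₀
  have ha₀v := soloInformed_single_add_single_apply (b 0 + m - b 1) (b 1)
  rw [← ha₀] at ha₀v
  have hiff : ∀ a ∈ F.support,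
      (Finsupp.single (0 : Fin 2) (a 0 + a 1 - m) + Finsupp.single 1 (a 1) = b) ↔
        (b 1 ≤ b 0 + m ∧ a = a₀) := by
    intro a ha
    have hav := soloInformed_single_add_single_apply (a 0 + a 1 - m) (a 1)
    have hma := hm a ha
    constructor
    · intro h
      have hb0 : b 0 = a 0 + a 1 - m := by rw [← h]; exact hav.1
      have hb1 : b 1 = a 1 := by rw [← h]; exact hav.2
      refine ⟨by omega, ?_⟩
      ext j
      fin_cases j
      · show a 0 = a₀ 0
        rw [ha₀v.1]; omega
      · show a 1 = a₀ 1
        rw [ha₀v.2]; omega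
    · rintro ⟨hb, rfl⟩
      ext j
      fin_cases j
      · show (Finsupp.single (0 : Fin 2) (a₀ 0 + a₀ 1 - m) + Finsupp.single (1 : Fin 2) (a₀ 1) :
          Fin 2 →₀ ℕ) 0 = b 0
        rw [(soloInformed_single_add_single_apply _ _).1, ha₀v.1, ha₀v.2]; omega
      · show (Finsupp.single (0 : Fin 2) (a₀ 0 + a₀ 1 - m) + Finsupp.single (1 : Fin 2) (a₀ 1) :
          Fin 2 →₀ ℕ) 1 = b 1
        rw [(soloInformed_single_add_single_apply _ _).2, ha₀v.2]
  rw [Finset.sum_congr rfl fun a ha => if_congr (hiff a ha) rfl rfl]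
  by_cases hb : b 1 ≤ b 0 + m
  · simp only [hb, true_and, if_true]
    rw [Finset.sum_ite_eq']
    split_ifs with h
    · rfl
    · exact (MvPolynomial.notMem_support_iff.1 h).symm
  · simp [hb]

/-! ### The cone polynomial -/

/-- The **cone polynomial** `cone_F(t) = F_low(0, t) = F_m(1, t)` of `F` for the multiplicity `m`.
[this work] -/
def soloInformedConePolyK (F : MvPolynomial (Fin 2) K) (m : ℕ) : Polynomial K :=
  soloInformedEdgePolyK 1 (soloInformedBlowLowK F m)

/-- Values on the exceptional edge are values of the cone polynomial. [this work] -/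
theorem soloInformed_aeval_edge_blowLowK (F : MvPolynomial (Fin 2) K) (m : ℕ) (t : ℝ) :
    (MvPolynomial.aeval ![0, t] (soloInformedBlowLowK F m) : ℝ) =
      Polynomial.aeval t (soloInformedConePolyK F m) := by
  unfold soloInformedConePolyK
  rw [soloInformed_aeval_edgePolyK]
  have h : (fun j => if j = (1 : Fin 2) then t else (0 : ℝ)) = ![0, t] := by
    funext j
    fin_cases j <;> simp
  rw [h]

omit [Algebra K ℝ] in
/-- Coefficients of the cone polynomial: `coeff k = coeff (x₀^{m−k} x₁^k) F` for `k ≤ m`.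
[this work] -/
theorem soloInformed_coeff_conePolyK (F : MvPolynomial (Fin 2) K) {m : ℕ}
    (hm : ∀ a ∈ F.support, m ≤ a 0 + a 1) (k : ℕ) :
    (soloInformedConePolyK F m).coeff k =
      if k ≤ m then MvPolynomial.coeff (Finsupp.single 0 (m - k) + Finsupp.single 1 k) F else 0 := by
  unfold soloInformedConePolyK
  rw [soloInformed_coeff_edgePolyK, soloInformed_coeff_blowLowK F hm]
  have h0 : (Finsupp.single (1 : Fin 2) k : Fin 2 →₀ ℕ) 0 = 0 := by simp
  have h1 : (Finsupp.single (1 : Fin 2) k : Fin 2 →₀ ℕ) 1 = k := by simp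
  rw [h0, h1, zero_add]

omit [Algebra K ℝ] in
/-- The cone polynomial has degree at most `m`. [this work] -/
theorem soloInformed_natDegree_conePolyK_le (F : MvPolynomial (Fin 2) K) {m : ℕ}
    (hm : ∀ a ∈ F.support, m ≤ a 0 + a 1) : (soloInformedConePolyK F m).natDegree ≤ m := by
  rw [Polynomial.natDegree_le_iff_coeff_eq_zero]
  intro k hk
  rw [soloInformed_coeff_conePolyK F hm, if_neg (by exact_mod_cast not_le.2 hk)]

omit [Algebra K ℝ] in
/-- The cone polynomial of a polynomial of multiplicity exactly `m` is non-zero. [this work] -/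
theorem soloInformed_conePolyK_ne_zero (F : MvPolynomial (Fin 2) K) {m : ℕ}
    (hm : ∀ a ∈ F.support, m ≤ a 0 + a 1) {a : Fin 2 →₀ ℕ} (ha : a ∈ F.support)
    (hdeg : a 0 + a 1 = m) : soloInformedConePolyK F m ≠ 0 := by
  intro h
  have hk := soloInformed_coeff_conePolyK F hm (a 1)
  rw [h, Polynomial.coeff_zero, if_pos (by omega)] at hk
  have ha' : Finsupp.single (0 : Fin 2) (m - a 1) + Finsupp.single 1 (a 1) = a := by
    ext j
    fin_cases j
    · show (Finsupp.single (0 : Fin 2) (m - a 1) + Finsupp.single (1 : Fin 2) (a 1) : Fin 2 →₀ ℕ) 0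
        = a 0
      rw [(soloInformed_single_add_single_apply _ _).1]; omega
    · exact (soloInformed_single_add_single_apply _ _).2
  rw [ha'] at hk
  exact MvPolynomial.mem_support_iff.1 ha hk.symm

/-! ### The cone polynomial of the swap -/

omit [Algebra K ℝ] in
/-- Monomials of the swap have the same total degrees. [this work] -/
theorem soloInformed_le_deg_swapK {F : MvPolynomial (Fin 2) K} {m : ℕ}
    (hm : ∀ a ∈ F.support, m ≤ a 0 + a 1) :
    ∀ a ∈ (soloInformedSwapK F).support, m ≤ a 0 + a 1 := fun a ha => by
  obtain ⟨b, hb, h0, h1⟩ := soloInformed_support_swapK ha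
  rw [h0, h1, add_comm (b 1)]; exact hm b hb

omit [Algebra K ℝ] in
/-- Coefficients of the swap. [this work] -/
theorem soloInformed_coeff_swapK (F : MvPolynomial (Fin 2) K) (i k : ℕ) :
    MvPolynomial.coeff (Finsupp.single 0 i + Finsupp.single 1 k) (soloInformedSwapK F) =
      MvPolynomial.coeff (Finsupp.single 0 k + Finsupp.single 1 i) F := by
  have h := MvPolynomial.coeff_rename_mapDomain (Equiv.swap (0 : Fin 2) 1)
    (Equiv.swap (0 : Fin 2) 1).injective F (Finsupp.single 0 k + Finsupp.single 1 i)
  rw [Finsupp.mapDomain_add, Finsupp.mapDomain_single, Finsupp.mapDomain_single,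
    Equiv.swap_apply_left, Equiv.swap_apply_right, add_comm] at h
  exact h

omit [Algebra K ℝ] in
/-- **The cone polynomial of the swap is the reflection of the cone polynomial.** [this work] -/
theorem soloInformed_conePolyK_swapK (F : MvPolynomial (Fin 2) K) {m : ℕ}
    (hm : ∀ a ∈ F.support, m ≤ a 0 + a 1) :
    soloInformedConePolyK (soloInformedSwapK F) m = (soloInformedConePolyK F m).reflect m := by
  ext k
  rw [Polynomial.coeff_reflect, soloInformed_coeff_conePolyK _ (soloInformed_le_deg_swapK hm),
    soloInformed_coeff_conePolyK F hm]
  by_cases hk : k ≤ m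
  · rw [if_pos hk, Polynomial.revAt_le hk, if_pos (Nat.sub_le m k), soloInformed_coeff_swapK,
      Nat.sub_sub_self hk]
  · rw [if_neg hk, Polynomial.revAt_eq_self_of_lt (not_le.1 hk), if_neg hk]

/-- Values of the cone polynomial of the swap away from `0`: `cone_{swap F}(s) = s^m cone_F(1/s)`.
[this work] -/
theorem soloInformed_aeval_conePolyK_swapK (F : MvPolynomial (Fin 2) K) {m : ℕ}
    (hm : ∀ a ∈ F.support, m ≤ a 0 + a 1) {s : ℝ} (hs : s ≠ 0) :
    (Polynomial.aeval s (soloInformedConePolyK (soloInformedSwapK F) m) : ℝ) =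
      s ^ m * Polynomial.aeval s⁻¹ (soloInformedConePolyK F m) := by
  rw [soloInformed_conePolyK_swapK F hm]
  letI : Invertible (s⁻¹ : ℝ) := invertibleOfNonzero (inv_ne_zero hs)
  have h := Polynomial.eval₂_reflect_mul_pow (algebraMap K ℝ) s⁻¹ m (soloInformedConePolyK F m)
    (soloInformed_natDegree_conePolyK_le F hm)
  rw [invOf_eq_inv, inv_inv] at h
  rw [Polynomial.aeval_def, Polynomial.aeval_def, ← h, inv_pow, mul_comm (s ^ m),
    mul_assoc, inv_mul_cancel₀ (pow_ne_zero m hs), mul_one]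

/-- The value of the cone polynomial of the swap at `0` is the top coefficient of the cone
polynomial. [this work] -/
theorem soloInformed_aeval_zero_conePolyK_swapK (F : MvPolynomial (Fin 2) K) {m : ℕ}
    (hm : ∀ a ∈ F.support, m ≤ a 0 + a 1) :
    (Polynomial.aeval (0 : ℝ) (soloInformedConePolyK (soloInformedSwapK F) m) : ℝ) =
      algebraMap K ℝ ((soloInformedConePolyK F m).coeff m) := by
  rw [← Polynomial.coeff_zero_eq_aeval_zero', soloInformed_conePolyK_swapK F hm,
    Polynomial.coeff_reflect, Polynomial.revAt_le (Nat.zero_le m), Nat.sub_zero]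

/-! ### The child germs on the exceptional edge -/

omit [Algebra K ℝ] in
/-- **The child germ on the edge**: `child_{t,κ,λ}(0, x₁) = cone_F(t + λ x₁)`. [this work] -/
theorem soloInformed_edgePolyK_childK (F : MvPolynomial (Fin 2) K) (m : ℕ) (t κ lam : K) :
    soloInformedEdgePolyK 1 (soloInformedChildK F m t κ lam) =
      (soloInformedConePolyK F m).comp (C t + C lam * X) := by
  unfold soloInformedConePolyK soloInformedEdgePolyK soloInformedChildK soloInformedScaleSubstK
  set e : Fin 2 → Polynomial K := fun j => if j = (1 : Fin 2) then X else 0 with he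
  set B := soloInformedBlowLowK F m
  have hR : Polynomial.aeval (C t + C lam * X) (MvPolynomial.aeval e B) =
      MvPolynomial.aeval (fun i => Polynomial.aeval (C t + C lam * X) (e i)) B := by
    rw [← AlgHom.comp_apply, MvPolynomial.comp_aeval]
  have h0 : (fun i => MvPolynomial.aeval e (if i = (0 : Fin 2) then
      MvPolynomial.C 0 + MvPolynomial.C κ * MvPolynomial.X i else MvPolynomial.X i :
        MvPolynomial (Fin 2) K)) = e := by
    funext i
    fin_cases i <;> simp [he]
  have h1 : (fun i => MvPolynomial.aeval e (if i = (1 : Fin 2) then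
      MvPolynomial.C t + MvPolynomial.C lam * MvPolynomial.X i else MvPolynomial.X i :
        MvPolynomial (Fin 2) K)) =
      fun i => Polynomial.aeval (C t + C lam * X) (e i) := by
    funext i
    fin_cases i
    · simp [he]
    · simp [he, Polynomial.aeval_X]
  rw [Polynomial.comp_eq_aeval, hR, MvPolynomial.aeval_bind₁, h0, MvPolynomial.aeval_bind₁, h1]

omit [Algebra K ℝ] in
/-- **Multiplicity of a child**: if `cone_F(t + λ·)` has a degree-`k` term, the child at `t` has
multiplicity `≤ k`. [this work] -/
theorem soloInformed_multK_childK_le {F : MvPolynomial (Fin 2) K} {m : ℕ} {t κ lam : K} {k : ℕ}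
    (h : ((soloInformedConePolyK F m).comp (C t + C lam * X)).coeff k ≠ 0) :
    soloInformedMultK (soloInformedChildK F m t κ lam) ≤ k := by
  rw [← soloInformed_edgePolyK_childK, soloInformed_coeff_edgePolyK] at h
  refine (soloInformed_multK_le (MvPolynomial.mem_support_iff.2 h)).trans ?_
  simp

/-! ### The pure-power lemma -/

omit [Algebra K ℝ] in
/-- **The pure-power lemma.**  If `p ∈ K[X]` has degree `≤ m`, `λ ≠ 0`, and `p(t + λX)` has no term
of degree `< m`, then `p = c · (X − t)^m` with `c = coeff_m(p(t + λX)) · λ^{-m}`. [this work] -/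
theorem soloInformed_eq_C_mul_X_sub_C_pow {p : Polynomial K} {m : ℕ} {t lam : K} (hlam : lam ≠ 0)
    (hdeg : p.natDegree ≤ m) (h : ∀ k < m, (p.comp (C t + C lam * X)).coeff k = 0) :
    p = C ((p.comp (C t + C lam * X)).coeff m * lam⁻¹ ^ m) * (X - C t) ^ m := by
  set q := p.comp (C t + C lam * X) with hqdef
  have hqdeg : q.natDegree ≤ m := by
    refine (Polynomial.natDegree_comp_le).trans ?_
    have h1 : (C t + C lam * X).natDegree ≤ 1 := by
      rw [add_comm]; exact Polynomial.natDegree_linear_le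
    calc p.natDegree * (C t + C lam * X).natDegree ≤ m * 1 := Nat.mul_le_mul hdeg h1
      _ = m := mul_one m
  have hq : q = C (q.coeff m) * X ^ m := by
    ext k
    rw [Polynomial.coeff_C_mul_X_pow]
    rcases lt_trichotomy k m with hk | rfl | hk
    · rw [if_neg hk.ne]; exact h k hk
    · rw [if_pos rfl]
    · rw [if_neg hk.ne']
      exact Polynomial.coeff_eq_zero_of_natDegree_lt (lt_of_le_of_lt hqdeg hk)
  set r : Polynomial K := C lam⁻¹ * (X - C t) with hr
  have hcomp : (C t + C lam * X).comp r = X := by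
    rw [Polynomial.add_comp, Polynomial.mul_comp, Polynomial.C_comp, Polynomial.C_comp,
      Polynomial.X_comp, hr, ← mul_assoc, ← C_mul, mul_inv_cancel₀ hlam, C_1, one_mul,
      add_sub_cancel]
  calc p = p.comp X := p.comp_X.symm
    _ = q.comp r := by rw [← hcomp, ← Polynomial.comp_assoc]
    _ = (C (q.coeff m) * X ^ m).comp r := by rw [← hq]
    _ = C (q.coeff m * lam⁻¹ ^ m) * (X - C t) ^ m := by
      rw [Polynomial.C_mul_comp, Polynomial.X_pow_comp, hr, mul_pow, ← C_pow, C_mul, mul_assoc]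

omit [Algebra K ℝ] in
/-- **Multiplicity drops at non-pure tangent directions.**  If `λ ≠ 0`, all monomials of `F` have
degree `≥ m`, and the cone polynomial is not of the form `c · (X − t)^m`, then the child germ at `t`
has multiplicity `< m`. [this work] -/
theorem soloInformed_multK_childK_lt_of_not_pow {F : MvPolynomial (Fin 2) K} {m : ℕ}
    (hm : ∀ a ∈ F.support, m ≤ a 0 + a 1) {t κ lam : K} (hlam : lam ≠ 0)
    (h : ∀ c : K, soloInformedConePolyK F m ≠ C c * (X - C t) ^ m) :
    soloInformedMultK (soloInformedChildK F m t κ lam) < m := by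
  by_contra hge
  refine h _ (soloInformed_eq_C_mul_X_sub_C_pow hlam (soloInformed_natDegree_conePolyK_le F hm)
    fun k hk => ?_)
  by_contra hk0
  exact hge ((soloInformed_multK_childK_le (κ := κ) hk0).trans_lt hk)

omit [Algebra K ℝ] in
/-- **The pure-power case**: if `cone_F = c · (X − t)^m`, then `cone_F(t + λX) = c λ^m X^m`; in
particular its degree-`m` coefficient is `c λ^m`. [this work] -/
theorem soloInformed_conePolyK_comp_of_pow {F : MvPolynomial (Fin 2) K} {m : ℕ} {c t : K}
    (h : soloInformedConePolyK F m = C c * (X - C t) ^ m) (lam : K) :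
    (soloInformedConePolyK F m).comp (C t + C lam * X) = C (c * lam ^ m) * X ^ m := by
  rw [h, Polynomial.C_mul_comp, Polynomial.pow_comp, Polynomial.sub_comp, Polynomial.X_comp,
    Polynomial.C_comp, add_sub_cancel_left, mul_pow, ← C_pow, C_mul, mul_assoc]

omit [Algebra K ℝ] in
/-- In the pure-power case the child at `t` has multiplicity `≤ m` (for `c λ ≠ 0`). [this work] -/
theorem soloInformed_multK_childK_le_of_pow {F : MvPolynomial (Fin 2) K} {m : ℕ} {c t : K}
    (h : soloInformedConePolyK F m = C c * (X - C t) ^ m) (hc : c ≠ 0) (κ : K) {lam : K}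
    (hlam : lam ≠ 0) : soloInformedMultK (soloInformedChildK F m t κ lam) ≤ m := by
  refine soloInformed_multK_childK_le (κ := κ) ?_
  rw [soloInformed_conePolyK_comp_of_pow h lam, Polynomial.coeff_C_mul_X_pow, if_pos rfl]
  exact mul_ne_zero hc (pow_ne_zero m hlam)

omit [Algebra K ℝ] in
/-- In the pure-power case the child at `t` has pure `x₁^m`-coefficient `c λ^m`. [this work] -/
theorem soloInformed_coeff_childK_of_pow {F : MvPolynomial (Fin 2) K} {m : ℕ} {c t : K}
    (h : soloInformedConePolyK F m = C c * (X - C t) ^ m) (κ lam : K) :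
    MvPolynomial.coeff (Finsupp.single 1 m) (soloInformedChildK F m t κ lam) = c * lam ^ m := by
  rw [← soloInformed_coeff_edgePolyK, soloInformed_edgePolyK_childK,
    soloInformed_conePolyK_comp_of_pow h lam, Polynomial.coeff_C_mul_X_pow, if_pos rfl]

/-- Values of a pure-power cone polynomial. [this work] -/
theorem soloInformed_aeval_conePolyK_of_pow {F : MvPolynomial (Fin 2) K} {m : ℕ} {c t : K}
    (h : soloInformedConePolyK F m = C c * (X - C t) ^ m) (s : ℝ) :
    (Polynomial.aeval s (soloInformedConePolyK F m) : ℝ) =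
      algebraMap K ℝ c * (s - algebraMap K ℝ t) ^ m := by
  rw [h, map_mul, map_pow, map_sub, Polynomial.aeval_C, Polynomial.aeval_X, Polynomial.aeval_C]

end Summit.KontsevichZagierPeriods.KontsevichZagierPeriods.Theorems
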